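import Mathlib
import Summits.ValiantsHypothesis.ValiantsHypothesis.Theorems.NewtonUnitEquationsDissociatedUniformTotalsLaw
import Summits.ValiantsHypothesis.ValiantsHypothesis.Theorems.NewtonUnitEquationsDissociatedUniformTotalsLawUnion
import Summits.ValiantsHypothesis.ValiantsHypothesis.Theorems.NewtonUnitEquationsDissociatedUniformTotalsLawIntervalUnion
import Summits.ValiantsHypothesis.ValiantsHypothesis.Theorems.NewtonUnitEquationsDissociatedUniformTotalsLawIntervalUnionLinearRuns
import HarnessLib

/-!
# Crux `NewtonUnitEquations.DissociatedUniform` (stmt-ValiantsHypothesis-5905), `n = 3` totals law of model (Q**):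
# THE LAW WITH A CONSTANT LINEAR IN THE NUMBER OF RUNS OF THE THIRD CURVE — `T(a,b,c) ≤ (2 + 24·R(c))·q²`, arbitrary curves

The `n = 3` totals law `T(a,b,c) ≤ C·q²` (`TotalsLawThree C`, OPEN; located `C = 3`, sharp form `2q² + O(q)`) is proved here with a
constant that depends on ONE intrinsic parameter of ONE of the three curves: the number of RUNS `R(c) = #runStarts c`
(`runStarts c = {z : c z ≠ c (z − 1)}`; `R = 0` iff `c` is constant):
* `classVert_le_runs : V_s ≤ (2 + 24·R(c))·q` — POINTWISE, every class, for ALL `a b c : ℤ/q → ℝ²`;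
* `totalVert_le_runs : T(a,b,c) ≤ (2 + 24·R(c))·q²` (by `…TotalsLaw.totalVert_rotate`/`_swap` the same holds with the runs of `a`
  or of `b`).
So the law holds uniformly on every stratum `{R(c) ≤ R₀}` (constant third curve: `2q²`, the tree's `C = 2`; `R₀` runs: `(2 + 24R₀)q²`),
interpolating between the constant stratum and the general case (`R = q`, where the bound is the trivial cubic one); no convexity,
injectivity or general position is assumed.  Mechanism: the level sets of `c` are unions of its runs, each run a cyclic window
(`runStart`, `runLen`, `runStart_eq_iff`, `level_eq_biUnion_runs`), so `V_s ≤ Σ_v #vert conv U_s(c⁻¹ v) ≤ Σ_v #{runs of value v}·24q`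
by the log-free interval union bound (`…IntervalUnionLinearRuns.unionVert_intervals_le`, from `IntervalUnionVertBound 24`).
Honest label: `TotalsLawThree C` (a constant independent of `R`) remains OPEN and is asserted nowhere; nothing here bears on VP ≠ VNP.
[folklore]
-/

set_option linter.dupNamespace false -- `ValiantsHypothesis.ValiantsHypothesis` (summit = problem) in every name

open Finset
open scoped Pointwise

namespace Summit.ValiantsHypothesis.ValiantsHypothesis.Theorems.NewtonUnitEquationsDissociatedUniform

namespace TotalsLaw

/-! ### The `n = 3` totals law with constant linear in the number of RUNS of the third curve -/

section RunsLaw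

variable {q : ℕ} [NeZero q]

/-- The RUN STARTS of a curve `c : ℤ/q → ℝ²`: labels where the value differs from the predecessor's.  Their number `R(c)` is the
number of runs of `c` around the cycle (`0` iff `c` is constant). -/
noncomputable def runStarts [DecidableEq (Fin 2 → ℝ)] (c : ZMod q → (Fin 2 → ℝ)) : Finset (ZMod q) :=
  Finset.univ.filter fun z => c z ≠ c (z - 1)

variable [DecidableEq (Fin 2 → ℝ)] {c : ZMod q → (Fin 2 → ℝ)}

/-- Along a stretch without run starts the curve is constant. [folklore] -/
theorem apply_add_eq_of_no_start (c : ZMod q → (Fin 2 → ℝ)) (z : ZMod q) :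
    ∀ k : ℕ, (∀ n : ℕ, 1 ≤ n → n ≤ k → z + (n : ZMod q) ∉ runStarts c) → c (z + (k : ZMod q)) = c z := by
  intro k
  induction k with
  | zero => intro _; simp
  | succ k ih =>
    intro h
    have hk : z + ((k + 1 : ℕ) : ZMod q) ∉ runStarts c := h (k + 1) (by omega) le_rfl
    rw [runStarts, Finset.mem_filter, not_and, not_not] at hk
    have h1 := hk (Finset.mem_univ _)
    rw [h1, show z + ((k + 1 : ℕ) : ZMod q) - 1 = z + (k : ZMod q) by push_cast; ring]
    exact ih fun n hn hnk => h n hn (Nat.le_succ_of_le hnk)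

/-- With no run start at all, the curve is constant. [folklore] -/
theorem apply_eq_of_runStarts_eq_empty (h : runStarts c = ∅) (z w : ZMod q) : c w = c z := by
  have hw : w = z + (((w - z).val : ℕ) : ZMod q) := by rw [ZMod.natCast_zmod_val]; ring
  rw [hw]
  exact apply_add_eq_of_no_start c z (w - z).val fun n _ _ => by rw [h]; exact Finset.notMem_empty _

/-- If there is a run start, every label has one at most `q − 1` steps behind it. [folklore] -/
theorem exists_start_behind {z₀ : ZMod q} (hz₀ : z₀ ∈ runStarts c) (w : ZMod q) :
    ∃ n : ℕ, w - (n : ZMod q) ∈ runStarts c :=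
  ⟨(w - z₀).val, by rw [ZMod.natCast_zmod_val, sub_sub_cancel]; exact hz₀⟩

/-- … and one at least one and at most `q` steps ahead of it. [folklore] -/
theorem exists_start_ahead {z₀ : ZMod q} (hz₀ : z₀ ∈ runStarts c) (z : ZMod q) :
    ∃ n : ℕ, 1 ≤ n ∧ z + (n : ZMod q) ∈ runStarts c :=
  ⟨(z₀ - z - 1).val + 1, by omega, by
    rw [Nat.cast_add, ZMod.natCast_zmod_val, Nat.cast_one, show z + (z₀ - z - 1 + 1) = z₀ by ring]; exact hz₀⟩

/-- The number of steps back from `w` to the start of its run. -/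
noncomputable def runBack {z₀ : ZMod q} (hz₀ : z₀ ∈ runStarts c) (w : ZMod q) : ℕ :=
  Nat.find (exists_start_behind hz₀ w)

/-- The start of the run of `w`. -/
noncomputable def runStart {z₀ : ZMod q} (hz₀ : z₀ ∈ runStarts c) (w : ZMod q) : ZMod q :=
  w - (runBack hz₀ w : ZMod q)

/-- The length of the run starting at `z`: the number of steps to the next run start (`1 ≤ · ≤ q`). -/
noncomputable def runLen {z₀ : ZMod q} (hz₀ : z₀ ∈ runStarts c) (z : ZMod q) : ℕ :=
  Nat.find (exists_start_ahead hz₀ z)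

/-- The run start of `w` is a run start. [folklore] -/
theorem runStart_mem {z₀ : ZMod q} (hz₀ : z₀ ∈ runStarts c) (w : ZMod q) : runStart hz₀ w ∈ runStarts c :=
  Nat.find_spec (exists_start_behind hz₀ w)

/-- No run start strictly closer behind `w` than its run start. [folklore] -/
theorem not_mem_of_lt_runBack {z₀ : ZMod q} (hz₀ : z₀ ∈ runStarts c) (w : ZMod q) {n : ℕ} (hn : n < runBack hz₀ w) :
    w - (n : ZMod q) ∉ runStarts c :=
  Nat.find_min (exists_start_behind hz₀ w) hn

/-- `1 ≤ runLen` and `z + runLen ∈ runStarts`. [folklore] -/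
theorem runLen_spec {z₀ : ZMod q} (hz₀ : z₀ ∈ runStarts c) (z : ZMod q) :
    1 ≤ runLen hz₀ z ∧ z + (runLen hz₀ z : ZMod q) ∈ runStarts c :=
  Nat.find_spec (exists_start_ahead hz₀ z)

/-- No run start strictly inside the run. [folklore] -/
theorem not_mem_of_lt_runLen {z₀ : ZMod q} (hz₀ : z₀ ∈ runStarts c) (z : ZMod q) {n : ℕ} (h1 : 1 ≤ n)
    (hn : n < runLen hz₀ z) : z + (n : ZMod q) ∉ runStarts c := fun h =>
  Nat.find_min (exists_start_ahead hz₀ z) hn ⟨h1, h⟩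

/-- `c` is constant on the run of `w`: `c (runStart w) = c w`. [folklore] -/
theorem apply_runStart {z₀ : ZMod q} (hz₀ : z₀ ∈ runStarts c) (w : ZMod q) : c (runStart hz₀ w) = c w := by
  have h := apply_add_eq_of_no_start c (runStart hz₀ w) (runBack hz₀ w) fun n hn hnk => by
    rw [runStart, show w - (runBack hz₀ w : ZMod q) + (n : ZMod q) = w - ((runBack hz₀ w - n : ℕ) : ZMod q) by
      rw [Nat.cast_sub hnk]; ring]
    exact not_mem_of_lt_runBack hz₀ w (by omega)
  rw [runStart] at h ⊢
  rw [← h, sub_add_cancel]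

/-- **The run of a start is a cyclic window:** `runStart w = z ↔ w ∈ [z, z + runLen z)` for a run start `z`. [folklore] -/
theorem runStart_eq_iff {z₀ : ZMod q} (hz₀ : z₀ ∈ runStarts c) {z : ZMod q} (hz : z ∈ runStarts c) (w : ZMod q) :
    runStart hz₀ w = z ↔ w ∈ cycInterval q z.val (runLen hz₀ z) := by
  rw [cycInterval, Finset.mem_image]
  obtain ⟨h1, hmem⟩ := runLen_spec hz₀ z
  constructor
  · intro h
    have hw : w = z + (runBack hz₀ w : ZMod q) := by rw [← h, runStart, sub_add_cancel]
    refine ⟨runBack hz₀ w, Finset.mem_range.2 ?_, by rw [Nat.cast_add, ZMod.natCast_zmod_val, ← hw]⟩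
    by_contra hge
    push Not at hge
    have hsub : w - (runBack hz₀ w : ZMod q) = z := h
    have heq : w - ((runBack hz₀ w - runLen hz₀ z : ℕ) : ZMod q) = z + (runLen hz₀ z : ZMod q) := by
      rw [Nat.cast_sub hge]; linear_combination hsub
    have hmem' := hmem
    rw [← heq] at hmem'
    exact not_mem_of_lt_runBack hz₀ w (by omega) hmem'
  · rintro ⟨n, hn, hnw⟩
    rw [Finset.mem_range] at hn
    have hw : w = z + (n : ZMod q) := by rw [← hnw, Nat.cast_add, ZMod.natCast_zmod_val]
    have hle : runBack hz₀ w ≤ n := Nat.find_min' _ (by rw [hw, add_sub_cancel_right]; exact hz)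
    have hge : n ≤ runBack hz₀ w := by
      by_contra hlt
      push Not at hlt
      have hmemS := runStart_mem hz₀ w
      have heq : runStart hz₀ w = z + ((n - runBack hz₀ w : ℕ) : ZMod q) := by
        rw [runStart, Nat.cast_sub hlt.le]; linear_combination hw
      rw [heq] at hmemS
      exact not_mem_of_lt_runLen hz₀ z (by omega) (by omega) hmemS
    have hBn : runBack hz₀ w = n := le_antisymm hle hge
    rw [runStart, hBn, hw, add_sub_cancel_right]

/-- **Level sets are unions of runs:** `c⁻¹{v} = ⋃_{z ∈ runStarts, c z = v} [z, z + runLen z)`. [folklore] -/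
theorem level_eq_biUnion_runs {z₀ : ZMod q} (hz₀ : z₀ ∈ runStarts c) (v : Fin 2 → ℝ) :
    c ⁻¹' {v} = ⋃ z ∈ (runStarts c).filter (fun z => c z = v),
      ((cycInterval q z.val (runLen hz₀ z) : Finset (ZMod q)) : Set (ZMod q)) := by
  ext w
  rw [Set.mem_preimage, Set.mem_singleton_iff, Set.mem_iUnion₂]
  constructor
  · intro hw
    refine ⟨runStart hz₀ w, Finset.mem_filter.2 ⟨runStart_mem hz₀ w, by rw [apply_runStart (c := c), hw]⟩, ?_⟩
    exact Finset.mem_coe.2 ((runStart_eq_iff hz₀ (runStart_mem hz₀ w) w).1 rfl)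
  · rintro ⟨z, hz, hwz⟩
    obtain ⟨hzS, hzv⟩ := Finset.mem_filter.1 hz
    have h := (runStart_eq_iff hz₀ hzS w).2 (Finset.mem_coe.1 hwz)
    rw [← hzv, ← h, apply_runStart (c := c)]

/-- **A level set of a curve with run starts is a fibre-union position set of at most `#{starts of that value}` windows:**
`#vert conv U_s(c⁻¹ v) ≤ #{z ∈ runStarts : c z = v}·24q`, for ALL `a, b`. [folklore] -/
theorem unionVert_level_le_runs {z₀ : ZMod q} (hz₀ : z₀ ∈ runStarts c) (a b : ZMod q → (Fin 2 → ℝ)) (v : Fin 2 → ℝ)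
    (s : ZMod q) :
    unionVert a b (c ⁻¹' {v}) s ≤ ((runStarts c).filter fun z => c z = v).card * (24 * q) := by
  have h := unionVert_intervals_le a b ((runStarts c).filter fun z => c z = v) (fun z => z.val) (fun z => runLen hz₀ z) s
  rw [level_eq_biUnion_runs hz₀ v]
  exact h

/-- **THE `n = 3` LAW WITH CONSTANT LINEAR IN THE NUMBER OF RUNS, POINTWISE:** for ALL `a b c : ℤ/q → ℝ²` and every class `s`,
`V_s ≤ (2 + 24·R(c))·q` where `R(c) = #runStarts c` is the number of runs of the third curve (`R = 0`: constant curve, `2q`). -/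
theorem classVert_le_runs (a b c : ZMod q → (Fin 2 → ℝ)) (s : ZMod q) :
    classVert a b c s ≤ (2 + 24 * (runStarts c).card) * q := by
  classical
  refine (classVert_le_sum_unionVert a b c s).trans ?_
  rcases (runStarts c).eq_empty_or_nonempty with h0 | ⟨z₀, hz₀⟩
  · -- constant third curve: one level set, `= univ`
    have himg : Finset.univ.image c = {c 0} := by
      refine Finset.eq_singleton_iff_unique_mem.2 ⟨Finset.mem_image.2 ⟨0, Finset.mem_univ _, rfl⟩, fun v hv => ?_⟩
      obtain ⟨z, -, rfl⟩ := Finset.mem_image.1 hv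
      exact apply_eq_of_runStarts_eq_empty h0 0 z
    have hlev : c ⁻¹' {c 0} = Set.univ := Set.eq_univ_of_forall fun z => apply_eq_of_runStarts_eq_empty h0 0 z
    rw [himg, Finset.sum_singleton, hlev, h0, Finset.card_empty]
    have := unionVert_univ_le a b s
    rw [ZMod.card] at this
    omega
  · calc ∑ v ∈ Finset.univ.image c, unionVert a b (c ⁻¹' {v}) s
        ≤ ∑ v ∈ Finset.univ.image c, ((runStarts c).filter fun z => c z = v).card * (24 * q) :=
          Finset.sum_le_sum fun v _ => unionVert_level_le_runs hz₀ a b v s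
      _ = (runStarts c).card * (24 * q) := by
          rw [← Finset.sum_mul, ← Finset.card_eq_sum_card_fiberwise fun z _ => Finset.mem_coe.2
            (Finset.mem_image.2 ⟨z, Finset.mem_univ _, rfl⟩)]
      _ ≤ (2 + 24 * (runStarts c).card) * q := by nlinarith

/-- **… and in TOTAL:** `T(a, b, c) ≤ (2 + 24·R(c))·q²` for ALL `a b c : ℤ/q → ℝ²`, `R(c)` the number of runs of `c` — the `n = 3`
totals law with a constant linear in the number of runs of one of the three curves (by the symmetry `totalVert_rotate`, of any). -/
theorem totalVert_le_runs (a b c : ZMod q → (Fin 2 → ℝ)) :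
    totalVert a b c ≤ (2 + 24 * (runStarts c).card) * q ^ 2 := by
  unfold totalVert
  calc ∑ s, classVert a b c s ≤ ∑ _s : ZMod q, (2 + 24 * (runStarts c).card) * q :=
        Finset.sum_le_sum fun s _ => classVert_le_runs a b c s
    _ = (2 + 24 * (runStarts c).card) * q ^ 2 := by rw [Finset.sum_const, Finset.card_univ, ZMod.card, smul_eq_mul]; ring

end RunsLaw

end TotalsLaw

end Summit.ValiantsHypothesis.ValiantsHypothesis.Theorems.NewtonUnitEquationsDissociatedUniform
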